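import Mathlib
import Summits.KontsevichZagierPeriods.Zeta5Search.LawA4Proof
import Summits.KontsevichZagierPeriods.Zeta5Search.DenomLaw.LawA4PalAggregate
import HarnessLib

/-!
# ζ(5) search — THEOREM A⁗′: `v_p(Cas_j(b)) ≥ 7 − 2M` under THEOREM A⁗'s hypotheses with (T3) weakened to (T3′) «double raise OR palindrome»

Cell `pub-zeta5` (HONEST FRAMING: systematic search; no irrationality claim unless certified), track «DENOM-LAW», seat `denom-prover-d1`
gen 10 (ATTEMPT-10).  `p`-adic valuations of the cell's OWN explicit rationals (the contiguity Casoratian `Cas_j(b) = W(b+e_j)V(b) − W(b)V(b+e_j)`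
of the Brown–Zudilin dual coefficients); nothing here is a statement about ζ(5); no γ of record moves; records in print UNMOVED.

THE STATEMENT (`lawA4Pal`).  Window prime `5 ≤ p ≤ b₀ < p² − 2`; frame `M ≥ 6` even, `T` a palindrome; (H0) every multipole class exponent
`≥ −M`, every single-pole class `ν ≥ −M + 1`; (T1) every class of exponent `−M` is non-self-conjugate with type list `T`; (T2) every pole class
with `ν = −M + 1` is a single raise of `T` or the odd-centre class of type `T`; **(T3′) every pole class with `ν = −M + 2` has a type list that
is an admissible double raise of `T` OR IS ITSELF A PALINDROME**.  Then `v_p(Cas_j(b)) ≥ 7 − 2M` for every admissible direction `j`.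
THEOREM A⁗ (`SecondOrder.LawA4`, `lawA4_holds`) is the case without the palindrome alternative; the deep layer may be EMPTY, in which case
the statement is a «centre + dropped neighbours» law: the odd-centre class alone at `−M + 1` (Lemma D kills the first digit, `φ ≡ 0` its
second-digit correction) and even-exponent palindromic classes at `−M + 2`, whose conjugate-pair first digits cancel.
Proof = the proof of `lawA4_holds` with `aggregate₄P` (file `DenomLaw/LawA4PalAggregate.lean`: the dropped pair contributes `0·τ(T) (mod p³)`)
and the transport `H5P_shift` below.

EVIDENCE / USE (exact censuses of this seat, HOME `denom-law/prover-d1/g10/`, ATTEMPT-10): (i) RULE R1 (`DenomLaw.RuleR1Casoratian`) at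
`p = 11` on ALL 3,706 octave-1 configurations: the landed ladder (rungs M/J/B/Y/O/X/I/U/E/CR/P, engine-d2 g17's evaluator) reaches R1's value
on 3,673 cells and is ONE SHORT on exactly 33 (types a=2 N=12 and a=6 N=16), all of which satisfy the hypotheses above at `M = 8` with an empty
deep layer and `7 − 2M = −9 =` R1's value (observed `−9` on 30, `−8` on 3); (ii) exhaustive small cells `b₀ ≤ 16` (every polytope vector, every
window prime, every admissible `j`): on the cells where A⁗′ fires and A⁗ does not, 0 violations; the A⁗ control reproduces `lawA4_holds` with 0
violations (port check).
-/

noncomputable section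

open Finset PowerSeries

namespace Summit.KontsevichZagierPeriods.Zeta5Search.SecondOrder

open Summit.KontsevichZagierPeriods.Zeta5Search.DualSeries (InBox)
open Summit.KontsevichZagierPeriods.Zeta5Search.WedgeDictionary (coeffW coeffV)
open Summit.KontsevichZagierPeriods.Zeta5Search.CasoratianValuation (InPolytope shift casoratian)
open Summit.KontsevichZagierPeriods.Zeta5Search.ClusterValuation
open Summit.KontsevichZagierPeriods.Zeta5Search.PadicSeries
open Summit.KontsevichZagierPeriods.Zeta5Search.BigPrime (shift_zero padicNorm_mul_le_one)
open Summit.KontsevichZagierPeriods.Zeta5Search.CellKit (two_mul_le_of_shift classExp_shift_eq unhit_of_classExp_eq netExp_shift_of_unhit)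

variable {p : ℕ} [hp : Fact p.Prime]

/-! ## §1 Transport of (T3′) to `b + e_j` -/

section Transport

variable (b : ℕ → ℤ) {j : ℕ} (hb : InPolytope b) (hb' : InPolytope (shift b j)) (hj1 : 1 ≤ j) (hj7 : j ≤ 7)
  (hpn : (p : ℤ) ≤ b 0) {M : ℕ} (hM : 6 ≤ M) {T : List ℤ}
  (H1 : ∀ x ∈ multipoleClasses b p, -(M : ℤ) ≤ classExp b p x)
  (H2 : ∀ y, y < p → classPoleCount b p y = 1 → -(M : ℤ) + 1 ≤ classNu b p y)
  (H3 : ∀ x ∈ multipoleClasses b p, classExp b p x = -(M : ℤ) → ¬ CentreIn b p x ∧ classTypeList b p x = T)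
  (H4 : ∀ y, y < p → 1 ≤ classPoleCount b p y → classNu b p y = -(M : ℤ) + 1 →
    isRaise T (classTypeList b p y) = true ∨ (¬ (2 : ℤ) ∣ b 0 ∧ CentreIn b p y ∧ classTypeList b p y = T))
  (H5P : ∀ z, z < p → 1 ≤ classPoleCount b p z → classNu b p z = -(M : ℤ) + 2 →
    isRaise2 T (classTypeList b p z) = true ∨ (classTypeList b p z).reverse = classTypeList b p z)
include hb hb' hj1 hj7 hpn hM H1 H2 H3 H4 H5P

/-- **(T3′) transports** to `b + e_j` (the proof of `H5_shift` verbatim: an unhit class keeps its type list, so (T3′) for `b` carries over;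
a class hit once was a single raise of `T` (or would be the odd-centre class, which cannot be hit once) and becomes a double raise). -/
theorem H5P_shift : ∀ z, z < p → 1 ≤ classPoleCount (shift b j) p z → classNu (shift b j) p z = -(M : ℤ) + 2 →
    isRaise2 T (classTypeList (shift b j) p z) = true ∨
      (classTypeList (shift b j) p z).reverse = classTypeList (shift b j) p z := by
  intro z hz h1 hnu
  have h0 : 0 ≤ b 0 := hb.1.1
  have hp0 : 0 < p := hp.out.pos
  have hzn : z ≤ (b 0).toNat := le_b0_of_lt b hpn hz
  have hpnN : p ≤ (b 0).toNat := by omega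
  have hcb := classPoleCount_shift_le b hb.1 hj1 p z
  have hge := classExp_shift_ge b hb.1 hj1 p z
  -- a tame single class has `ν ≥ 0`: so `ν⁺ = E⁺`
  have tame_nonneg : ∀ {c : ℕ → ℤ}, classPoleCount c p z = 1 → tameSingle c p z = true → 0 ≤ classNu c p z := by
    intro c h1' ht'; unfold classNu; rw [if_pos ⟨h1', ht'⟩]; exact le_max_right _ _
  have hEq : classNu (shift b j) p z = classExp (shift b j) p z := by
    by_contra hne
    have := (tame_of_classNu_ne (shift b j) hne).2; omega
  have hE' : classExp (shift b j) p z = -(M : ℤ) + 2 := by rw [← hEq]; exact hnu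
  -- a class of `b` that is tame single and still a pole class of `b + e_j` is impossible here
  have not_tame : ¬ (classPoleCount b p z = 1 ∧ tameSingle b p z = true) := by
    rintro ⟨h1b, ht⟩
    have ht' := tameSingle_shift b hb hb' hj1 hj7 h1b h1 ht
    have := tame_nonneg (by omega) ht'
    omega
  have hνb : classNu b p z = classExp b p z := by
    unfold classNu; rw [if_neg not_tame]
  by_cases heq : classExp (shift b j) p z = classExp b p z
  · -- unhit: everything transports
    have h1b : 1 ≤ classPoleCount b p z := by rw [← classPoleCount_shift_of_classExp_eq b hb.1 hj1 heq]; exact h1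
    rw [classTypeList_shift_of_unhit b hb hb' hj1 hj7 heq hzn]
    exact H5P z hz h1b (by rw [hνb, ← heq, hE'])
  -- hit: the moved points in the class
  have h2 := two_mul_le_of_shift b hj1 hj7 hb'
  have hsum := classExp_shift_eq b hb hj1 hj7 hb' p z
  set k₁ := (b j).toNat with hk₁
  set N := (b 0).toNat with hN
  have hk₁N : k₁ ≤ N := by
    have := hb.1.2 (j - 1) (mem_range.2 (by omega)); rw [show j - 1 + 1 = j by omega] at this
    rw [hk₁, hN]; have := this.1; omega
  set mv : ℕ → Prop := fun s => s = k₁ ∨ s = N - k₁ with hmv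
  have hcnt : classExp (shift b j) p z = classExp b p z + (((classSet b p z).filter mv).card : ℤ) := by
    rw [hsum, ← sum_boole]
  -- membership of a moved point in a class determines the residue
  have res_of_mem : ∀ {x s : ℕ}, x < p → s ∈ classSet b p x → s % p = x := fun {x s} hx hs => by
    have := (mem_filter.1 hs).2; rwa [Nat.mod_eq_of_lt hx] at this
  -- both moved points in the class force the class to be self-conjugate
  have self_of_both : k₁ ∈ classSet b p z → N - k₁ ∈ classSet b p z → CentreIn b p z := by
    intro hk hNk
    have h1' : k₁ ∈ classSet b p (conjClass b p z) := (mem_classSet_conj_iff b hzn hk₁N).2 hNk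
    have e1 := res_of_mem hz hk
    have e2 := res_of_mem (conjClass_lt b hp0 z) h1'
    exact (centreIn_iff_conjClass_eq b hpnN hz).2 (by rw [← e2, e1])
  -- ### the exponent of `z` in `b` is `−M+1` (one hit)
  have key : classExp b p z = -(M : ℤ) + 1 := by
    have hcard_le : ((classSet b p z).filter mv).card ≤ 2 := by
      calc ((classSet b p z).filter mv).card ≤ ({k₁, N - k₁} : Finset ℕ).card :=
            card_le_card fun s hs => by
              rcases (mem_filter.1 hs).2 with h | h
              · rw [h]; exact mem_insert_self _ _
              · rw [h]; exact mem_insert_of_mem (mem_singleton_self _)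
        _ ≤ 2 := card_le_two
    by_cases h2b : 2 ≤ classPoleCount b p z
    · have hEb := H1 z (mem_filter.2 ⟨mem_range.2 hz, h2b⟩)
      by_contra hne1
      -- then `E = −M` and the class is hit twice
      have hEm : classExp b p z = -(M : ℤ) := by omega
      have hc2 : ((classSet b p z).filter mv).card = 2 := by omega
      obtain ⟨s₁, s₂, hne, hpair⟩ := card_eq_two.1 hc2
      have hs₁ : s₁ ∈ (classSet b p z).filter mv := by rw [hpair]; exact mem_insert_self _ _
      have hs₂ : s₂ ∈ (classSet b p z).filter mv := by rw [hpair]; exact mem_insert_of_mem (mem_singleton_self _)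
      obtain ⟨hs₁c, hs₁m⟩ := mem_filter.1 hs₁
      obtain ⟨hs₂c, hs₂m⟩ := mem_filter.1 hs₂
      obtain ⟨hc, -⟩ := H3 z (mem_filter.2 ⟨mem_range.2 hz, h2b⟩) hEm
      apply hc
      rcases hs₁m with h₁ | h₁ <;> rcases hs₂m with h₂ | h₂
      · exact absurd (h₁.trans h₂.symm) hne
      · exact self_of_both (h₁ ▸ hs₁c) (h₂ ▸ hs₂c)
      · exact self_of_both (h₂ ▸ hs₂c) (h₁ ▸ hs₁c)
      · exact absurd (h₁.trans h₂.symm) hne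
    · have h1b : classPoleCount b p z = 1 := by omega
      have hnub := H2 z hz h1b
      omega
  have h1b : 1 ≤ classPoleCount b p z := le_trans h1 hcb
  have hnub : classNu b p z = -(M : ℤ) + 1 := by rw [hνb, key]
  have hc1 : ((classSet b p z).filter mv).card = 1 := by
    have := hcnt; rw [hE', key] at this; omega
  obtain ⟨s₀, hs₀⟩ := card_eq_one.1 hc1
  have hs₀mem : s₀ ∈ (classSet b p z).filter mv := by rw [hs₀]; exact mem_singleton_self _
  obtain ⟨hs₀c, hs₀mv⟩ := mem_filter.1 hs₀mem
  obtain ⟨hL, hL'⟩ := level_bounds' (p := p) b hzn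
  set L := topLevel b p z with hLdef
  -- the new exponents along the levels: a raise at the level `ℓ₀` of `s₀`
  have hs₀lv := hs₀c
  rw [LevelClass.classSet_level b hz hL hL'] at hs₀lv
  obtain ⟨ℓ₀, hℓ₀, rfl⟩ := mem_image.1 hs₀lv
  have hℓ₀L : ℓ₀ ≤ L := by have := mem_range.1 hℓ₀; omega
  have hnew : ∀ ℓ ≤ L, netExp (shift b j) (z + ℓ * p) = raiseAt (fun k => netExp b (z + k * p)) ℓ₀ ℓ := by
    intro ℓ hℓ
    rw [CellA.netExp_shift_eq b hb.1 hj1 hj7 h2, raiseAt]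
    have hmem : z + ℓ * p ∈ classSet b p z := LevelClass.level_mem b hz hL hL' hℓ
    by_cases hℓℓ : ℓ = ℓ₀
    · subst hℓℓ; rw [if_pos hs₀mv, if_pos rfl]
    · have hnot : ¬ mv (z + ℓ * p) := by
        intro h
        have : z + ℓ * p ∈ (classSet b p z).filter mv := mem_filter.2 ⟨hmem, h⟩
        rw [hs₀, mem_singleton] at this
        exact hℓℓ (LevelClass.level_injective hp0 z this)
      rw [if_neg hnot, if_neg hℓℓ, add_zero]
  have htop : topLevel (shift b j) p z = L := by rw [hLdef]; unfold topLevel; rw [shift_zero b hj1]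
  have hS : classTypeList (shift b j) p z = (List.range (L + 1)).map (raiseAt (fun k => netExp b (z + k * p)) ℓ₀) := by
    unfold classTypeList
    rw [htop]
    exact List.map_congr_left fun ℓ hℓ => hnew ℓ (by have := List.mem_range.1 hℓ; omega)
  refine Or.inl ?_
  rcases H4 z hz h1b hnub with hr | ⟨hodd, hcen, -⟩
  · -- a single raise of `T`, raised once more at level `ℓ₀`
    have hfneg : ∃ i ≤ L, netExp b (z + i * p) < 0 := by
      obtain ⟨q, hq⟩ := card_pos.1 (show 0 < ((classSet b p z).filter fun s => netExp b s < 0).card from h1b)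
      have hP : (classSet b p z).filter (fun s => netExp b s < 0) =
          ((range (L + 1)).filter fun k => netExp b (z + k * p) < 0).image fun k => z + k * p :=
        LevelClass.classPoles_level b hz hL hL' _ (fun k _ => rfl)
      rw [hP] at hq
      obtain ⟨k, hk, -⟩ := mem_image.1 hq
      obtain ⟨hkr, hkneg⟩ := mem_filter.1 hk
      exact ⟨k, by have := mem_range.1 hkr; omega, hkneg⟩
    have hTne : T ≠ [] := by
      rintro rfl
      rw [classTypeList_level b hL hL'] at hr
      unfold isRaise at hr
      simp only [List.length_nil, List.range_zero, List.any_nil, Bool.false_or, Bool.or_eq_true, beq_iff_eq,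
        List.nil_append, or_self] at hr
      have hlen := congrArg List.length hr
      simp only [List.length_map, List.length_range, List.length_cons, List.length_nil] at hlen
      obtain ⟨i, hi, hfi⟩ := hfneg
      have hL0 : L = 0 := by omega
      have hi0 : i = 0 := by omega
      subst hi0
      rw [hL0] at hr
      have h01 : netExp b (z + 0 * p) = 1 := by simpa using hr
      omega
    rw [← range_map_tList hTne, classTypeList_level b hL hL'] at hr
    rw [hS, ← range_map_tList hTne]
    set e := tList T
    set f : ℕ → ℤ := fun k => netExp b (z + k * p) with hfdef
    rcases isRaise_level hr with ⟨k, hk, hML, hfk⟩ | ⟨hML, hfk⟩ | ⟨hML, hfk⟩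
    · -- `T + δ_k + δ_ℓ₀`
      have e1 : (List.range (L + 1)).map (raiseAt f ℓ₀) = (List.range (L + 1)).map (raiseAt (raiseAt e k) ℓ₀) :=
        List.map_congr_left fun i hi => by
          have hi' := List.mem_range.1 hi
          simp only [raiseAt]; rw [hfk i (by omega)]; rfl
      rw [e1, ← raiseAtList_range_map, ← raiseAtList_range_map, hML]
      unfold isRaise2
      simp only [Bool.or_eq_true, List.any_eq_true, beq_iff_eq, List.mem_range, List.length_map, List.length_range]
      exact Or.inl (Or.inl (Or.inl (Or.inl ⟨k, by omega, ℓ₀, by omega, rfl⟩)))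
    · -- `1 :: T` raised at level `ℓ₀`
      rcases Nat.eq_zero_or_pos ℓ₀ with hℓ0 | hℓpos
      · -- `2 :: T`
        have e1 : (List.range (L + 1)).map (raiseAt f ℓ₀) = (List.range (L + 1)).map (raiseAt (consOne e) 0) :=
          List.map_congr_left fun i hi => by
            have hi' := List.mem_range.1 hi
            simp only [raiseAt, hℓ0]; rw [hfk i (by omega)]
        rw [e1, hML, ← consTwo_range_map]
        unfold isRaise2
        simp
      · -- `1 :: (T + δ_{ℓ₀−1})`
        have e1 : (List.range (L + 1)).map (raiseAt f ℓ₀) =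
            (List.range (L + 1)).map (consOne (raiseAt e (ℓ₀ - 1))) :=
          List.map_congr_left fun i hi => by
            have hi' := List.mem_range.1 hi
            simp only [raiseAt, consOne]; rw [hfk i (by omega), consOne]
            split_ifs <;> omega
        rw [e1, hML, ← cons_range_map, ← raiseAtList_range_map]
        unfold isRaise2
        simp only [Bool.or_eq_true, List.any_eq_true, beq_iff_eq, List.mem_range, List.length_map, List.length_range]
        exact Or.inl (Or.inl (Or.inl (Or.inr ⟨ℓ₀ - 1, by omega, Or.inl rfl⟩)))
    · -- `T ++ [1]` raised at level `ℓ₀`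
      by_cases hℓL : ℓ₀ = tTop T + 1
      · -- `T ++ [2]`
        have e1 : (List.range (L + 1)).map (raiseAt f ℓ₀) =
            (List.range (L + 1)).map (raiseAt (snocOne e (tTop T)) (tTop T + 1)) :=
          List.map_congr_left fun i hi => by
            have hi' := List.mem_range.1 hi
            simp only [raiseAt, hℓL]; rw [hfk i (by omega)]
        rw [e1, hML, ← snocTwo_range_map]
        unfold isRaise2
        simp
      · -- `(T + δ_ℓ₀) ++ [1]`
        have e1 : (List.range (L + 1)).map (raiseAt f ℓ₀) =
            (List.range (L + 1)).map (snocOne (raiseAt e ℓ₀) (tTop T)) :=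
          List.map_congr_left fun i hi => by
            have hi' := List.mem_range.1 hi
            simp only [raiseAt, snocOne]; rw [hfk i (by omega), snocOne]
            split_ifs <;> omega
        rw [e1, hML, ← snoc_range_map, ← raiseAtList_range_map]
        unfold isRaise2
        simp only [Bool.or_eq_true, List.any_eq_true, beq_iff_eq, List.mem_range, List.length_map, List.length_range]
        exact Or.inl (Or.inl (Or.inl (Or.inr ⟨ℓ₀, by omega, Or.inr rfl⟩)))
  · -- the odd-centre class cannot be hit exactly once: its point set is reflection symmetric
    exfalso
    have hself := (centreIn_iff_conjClass_eq b hpnN hz).1 hcen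
    have hsymm : ∀ s ∈ classSet b p z, N - s ∈ classSet b p z := fun s hs =>
      (mem_classSet_conj_iff b hzn (le_of_mem_classSet b hs)).1 (by rw [hself]; exact hs)
    have hb0 : (b 0 : ℤ) = N := (Int.toNat_of_nonneg h0).symm
    have hNodd : ¬ 2 ∣ N := fun h => hodd (by rw [hb0]; exact_mod_cast h)
    -- the reflected point is another moved point of the class
    set s₀ := z + ℓ₀ * p with hs₀def
    have hs₀N : s₀ ≤ N := le_of_mem_classSet b hs₀c
    have hother : N - s₀ ∈ (classSet b p z).filter mv := by
      refine mem_filter.2 ⟨hsymm _ hs₀c, ?_⟩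
      rcases hs₀mv with h | h
      · exact Or.inr (by rw [h])
      · exact Or.inl (by rw [h]; omega)
    rw [hs₀, mem_singleton] at hother
    rcases hs₀mv with h | h <;> omega

end Transport

/-! ## §2 THEOREM A⁗′ -/

/-- **THEOREM A⁗′.**  THEOREM A⁗ (`SecondOrder.LawA4`) with hypothesis (T3) weakened to (T3′): every pole class with `ν = −M + 2` has a type
list that is an admissible double raise of `T` OR a palindrome.  Conclusion unchanged: `v_p(Cas_j(b)) ≥ 7 − 2M`.  (Binder shape: the prime as the
ambient `[Fact p.Prime]`, `1 ≤ j ≤ 7` and `6 ≤ M even` as conjunctions; the `example` below recovers `LawA4`'s literal shape.) -/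
theorem lawA4Pal (b : ℕ → ℤ) (j M : ℕ) (T : List ℤ) (hb : InPolytope b) (hb' : InPolytope (shift b j)) (hj : 1 ≤ j ∧ j ≤ 7)
    (hp5 : 5 ≤ p) (hpb : (p : ℤ) ≤ b 0) (hwin : (b 0 + 2 : ℤ) < (p : ℤ) ^ 2) (hM : 6 ≤ M ∧ Even M) (hT : T.reverse = T)
    (H1 : ∀ x ∈ multipoleClasses b p, -(M : ℤ) ≤ classExp b p x)
    (H2 : ∀ y, y < p → classPoleCount b p y = 1 → -(M : ℤ) + 1 ≤ classNu b p y)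
    (H3 : ∀ x ∈ multipoleClasses b p, classExp b p x = -(M : ℤ) → ¬ CentreIn b p x ∧ classTypeList b p x = T)
    (H4 : ∀ y, y < p → 1 ≤ classPoleCount b p y → classNu b p y = -(M : ℤ) + 1 →
        isRaise T (classTypeList b p y) = true ∨ (¬ (2 : ℤ) ∣ b 0 ∧ CentreIn b p y ∧ classTypeList b p y = T))
    (H5P : ∀ z, z < p → 1 ≤ classPoleCount b p z → classNu b p z = -(M : ℤ) + 2 →
        isRaise2 T (classTypeList b p z) = true ∨ (classTypeList b p z).reverse = classTypeList b p z)
    (hcas : casoratian b j ≠ 0) : (7 : ℤ) - 2 * M ≤ padicValRat p (casoratian b j) := by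
  obtain ⟨hj1, hj7⟩ := hj
  obtain ⟨hM, hMe⟩ := hM
  have hprime : p.Prime := hp.out
  have hp0 : (p : ℚ) ≠ 0 := Nat.cast_ne_zero.2 hprime.ne_zero
  have hpneg : (-(p : ℚ)) ≠ 0 := neg_ne_zero.2 hp0
  have hp2 : p ≠ 2 := by omega
  -- the aggregates for `b` and `b + e_j`
  obtain ⟨A, hW, hV, hAW, hAV⟩ := aggregate₄P b hb hp5 hpb hwin M hM hMe T hT H1 H2 H3 H4 H5P
  have hpb' : (p : ℤ) ≤ shift b j 0 := by rw [shift_zero b hj1]; exact hpb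
  have hwin' : (shift b j 0 + 2 : ℤ) < (p : ℤ) ^ 2 := by rw [shift_zero b hj1]; exact hwin
  have H4' := H4_shift b hb hb' hj1 hj7 hpb hM H1 H2 H3 H4
  have H5P' := H5P_shift b hb hb' hj1 hj7 hpb hM H1 H2 H3 H4 H5P
  obtain ⟨A', hW', hV', hAW', hAV'⟩ := aggregate₄P (shift b j) hb' hp5 hpb' hwin' M hM hMe T hT
    (H1_shift b hb hj1 H1) (H2_shift b hb hb' hj1 hj7 hM H1 H2) (H3_shift b hb hb' hj1 hj7 hpb H1 H3) H4' H5P'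
  -- the minor
  set w := coeffW b / (-(p : ℚ)) ^ (-(M : ℤ) + 3)
  set v := coeffV b / (-(p : ℚ)) ^ (-(M : ℤ))
  set w' := coeffW (shift b j) / (-(p : ℚ)) ^ (-(M : ℤ) + 3)
  set v' := coeffV (shift b j) / (-(p : ℚ)) ^ (-(M : ℤ))
  have hdet := det₄ hp2 hW hV hW' hV' hAW hAV hAW' hAV'
  have hcasE : casoratian b j = (-(p : ℚ)) ^ (-(M : ℤ) + 3) * (-(p : ℚ)) ^ (-(M : ℤ)) * (w' * v - w * v') := by
    have e1 : coeffW b = w * (-(p : ℚ)) ^ (-(M : ℤ) + 3) := by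
      simp only [w]; rw [div_mul_cancel₀ _ (zpow_ne_zero _ hpneg)]
    have e2 : coeffV b = v * (-(p : ℚ)) ^ (-(M : ℤ)) := by
      simp only [v]; rw [div_mul_cancel₀ _ (zpow_ne_zero _ hpneg)]
    have e3 : coeffW (shift b j) = w' * (-(p : ℚ)) ^ (-(M : ℤ) + 3) := by
      simp only [w']; rw [div_mul_cancel₀ _ (zpow_ne_zero _ hpneg)]
    have e4 : coeffV (shift b j) = v' * (-(p : ℚ)) ^ (-(M : ℤ)) := by
      simp only [v']; rw [div_mul_cancel₀ _ (zpow_ne_zero _ hpneg)]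
    unfold casoratian
    rw [e1, e2, e3, e4]; ring
  apply val_ge_of_padicNorm_le hcas
  rw [hcasE, padicNorm.mul, padicNorm.mul, LevelClass.padicNorm_neg_p_zpow, LevelClass.padicNorm_neg_p_zpow]
  calc (p : ℚ) ^ (-(-(M : ℤ) + 3)) * (p : ℚ) ^ (-(-(M : ℤ))) * padicNorm p (w' * v - w * v')
      ≤ (p : ℚ) ^ (-(-(M : ℤ) + 3)) * (p : ℚ) ^ (-(-(M : ℤ))) * (p : ℚ) ^ (-(4 : ℤ)) :=
        mul_le_mul_of_nonneg_left hdet (mul_nonneg (zpow_p_nonneg _) (zpow_p_nonneg _))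
    _ = (p : ℚ) ^ (-((7 : ℤ) - 2 * M)) := by
        rw [← zpow_add₀ hp0, ← zpow_add₀ hp0]; congr 1; ring

/-- Sanity (an `example`, no declaration: `LawA4` is already PROVED in the tree as `lawA4_holds`): THEOREM A⁗ is the special case of
THEOREM A⁗′ without the palindrome alternative. -/
example : LawA4 := by
  intro b p j M T hb hb' hj1 hj7 hprime hp5 hpb hwin hM hMe hT H1 H2 H3 H4 H5 hcas
  haveI : Fact p.Prime := ⟨hprime⟩
  exact lawA4Pal b j M T hb hb' ⟨hj1, hj7⟩ hp5 hpb hwin ⟨hM, hMe⟩ hT H1 H2 H3 H4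
    (fun z hz h1 hν => Or.inl (H5 z hz h1 hν)) hcas

end Summit.KontsevichZagierPeriods.Zeta5Search.SecondOrder

end
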